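import Summits.QuantumFields.YangMills.Theorems.UnitScaleTiltHalvingTreeAxialStokes
import Summits.QuantumFields.YangMills.Theorems.UnitScaleTiltHalvingBlockAxialDoubleBar
import Literature.MathematicalPhysics.QuantumFieldTheory.Balaban1983to89.B7Prop1Local
import Literature.MathematicalPhysics.QuantumFieldTheory.Balaban1983to89.B7Prop6Flat
import HarnessLib

/-!
# Line H (`BirthV10.stub_halvingStep`, stmt-QuantumFields-19200) — LEMMA B-al-2, bricks (B-i)+(B-ii): ★ THE BLOCK-CONSTANT PAIR GAUGE
# of a block-axial comb field — exact one-step covariance on `ℤᵈ` ([Balaban1985Averaging] (11)∕(42)) and second-order-ready smallness on the pair box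

Cell `ym3-torus` (HUMAN RULING D-0037: YM₃ on T³ is ladder rung R3 — NOT d = 4, NOT infinite volume, NOT a mass gap, NOT the Clay problem), width seat `ym-ust-19200-w3` gen 10
(LEAD-H ★w5-19200 g7 WORD 10 (2): LEMMA B-al ≡ (N1); SIGNATURE B-al-2 v1 cea012fa, bricks (B-i)∕(B-ii)).  `--supports stmt-QuantumFields-19200 --as helper`; THEOREMS ONLY
(0 `def`, 0 `sorry`); count-neutral; nothing here claims B-al-2, `H42topCrossT`, (M2′), the stub, the crux or the gap.

WHAT.  In J3's gauge the comb tower `C_j = avgIter L U′ j` is BLOCK-AXIAL (`axialFn C (Lz) (Lz + r) = 1` on every block).  For the block pair of the `L`-bond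
`c = ⟨Lz, Lz + Le_κ⟩` the natural local gauge is BLOCK-CONSTANT: `v = 1` on `B(Lz)`, `v = g := axialFn C (Lz) (L(z + e_κ))` (the transporter along the axis, i.e. the one
crossing bond on it) on `B(L(z + e_κ))`.
* §1 `norm_mul_mul_inv_sub_one_le` — `‖a·b·c⁻¹ − 1‖ ≤ ‖a − 1‖ + ‖b − 1‖ + ‖c − 1‖` in `U1`.
* §2 ★ `dbavg_gaugeAct_eq_of_blockConst` — (B-ii): for such `v` (constant on each of the two blocks) the gauged field is again block-axial on both blocks, so its FLAT DOUBLE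
  BAR (89) is its single bar (42) (✓`HalvingBlockAxialDoubleBar.dbavg_eq_bavg_of_blockAxial`), which is EXACTLY covariant (lit ✓`B7Prop6Flat.bavg_gaugeAct_units`, print's (11), no window):
  `dbavg L (v•C) (Lz) κ = v(Lz) · bavg L C (Lz) κ · v(L(z + e_κ))⁻¹`.  With `avgIter_succ` this reads `C_{j+1}(z, κ)·g⁻¹ = dbavg L (v•C_j) (Lz) κ` — the left input of
  B-al-1 ✓`HalvingCombTorusOneStep.norm_mlog_dbavg_sub_mlog_dbarAvgU_le`.
* §3 ★ `norm_gaugeAct_pairGauge_sub_one_le` — (B-i): if moreover `C` has plaquettes `≤ p` on the corner box `Q = [Lz, bondHi L (Lz) κ]` of `c`, then EVERY bond of `v•C` in `Q`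
  satisfies `‖(v•C)(b) − 1‖ ≤ (2·d·L + 1)·(|bondHi − Lz|₁·p)` — LOCAL second-order-ready currency (`p = 2ε₀L^{2(j−k)}` at level `j`).  Route: `v•C = h•W₁` with
  `W₁ = (axialFn C (Lz))•C` the comb-axial gauge of `Q` (lit ✓`B8Lemma1NonAbelian.axial_bond_bound_sharp`: every bond of `W₁` in `Q` is within `|bondHi − Lz|₁·p` of `1`,
  for ANY `C`) and `h = v·(axialFn C (Lz))⁻¹`, which is `1` on `B(Lz)` and the comb transporter `axialFn W₁ (L(z+e_κ)) y` on `B(L(z+e_κ))` (block-axiality of `C` at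
  the second block), bounded by the tree walk ✓`HalvingTreeAxialStokes.tw_walk_box`.
HONEST SCOPE.  Two one-block-pair bricks on `ℤᵈ`; the torus side, the Lipschitz step and the level induction of B-al-2 are NOT here.

References: T. Bałaban, CMP **98** (1985) 17–51 [Balaban1985Averaging] ((11) p.19, (42) p.23, p.24 (axial gauge, locality), (89) p.31); CMP **102** (1985) 255–275
[Balaban1985UV3] ((27)–(28) p.263).
-/

set_option autoImplicit false

noncomputable section

open scoped BigOperators

namespace Summit.QuantumFields.YangMills.Theorems.HalvingCombPairGauge

open Literature.MathematicalPhysics.QuantumFieldTheory.Balaban1983to89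
open B7Prop1Explicit (Site e e_apply Letter hol hol_gaugeAct treeWord disp disp_treeWord boxVec axialFn gaugeAct l1 U1 mem_U1 hol_mem axialFn_mem gaugeAct_mem
  norm_inv_sub_one_le bavg Wcx l1_boxVec_le)
open B7Prop1Local (InBox bondHi)
open B7Prop3Flat (dbavg)
open B8Lemma1NonAbelian (lowPart PlaqSmall tw treeWord_eq_tw axial_bond_bound_sharp zsmul_e_apply e_nonneg boxVec_nonneg)
open Summit.QuantumFields.YangMills.Theorems.P1FlatCorePreGauge (l1_lowPart_sub_le)
open HalvingTreeAxialStokes (tw_walk_box)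
open HalvingBlockAxialDoubleBar (dbavg_eq_bavg_of_blockAxial hol_treeWord_boxVec_eq_one_of_axialFn)

variable {d : ℕ} {𝔸 : Type*} [NormedRing 𝔸] [NormOneClass 𝔸]

/-! ## §1 An elementary `U1` estimate -/

/-- `‖a·b·c⁻¹ − 1‖ ≤ ‖a − 1‖ + ‖b − 1‖ + ‖c − 1‖` for `a, b, c ∈ U1` (`‖a‖, ‖b‖ ≤ 1`, `‖c⁻¹ − 1‖ ≤ ‖c − 1‖`). [folklore] -/
theorem norm_mul_mul_inv_sub_one_le {a b c : 𝔸ˣ} (ha : a ∈ U1 𝔸) (hb : b ∈ U1 𝔸) (hc : c ∈ U1 𝔸) :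
    ‖((a * b * c⁻¹ : 𝔸ˣ) : 𝔸) - 1‖ ≤ ‖(a : 𝔸) - 1‖ + ‖(b : 𝔸) - 1‖ + ‖(c : 𝔸) - 1‖ := by
  rw [mul_assoc, Units.val_mul, Units.val_mul]
  have h2 : ‖(b : 𝔸) * ((c⁻¹ : 𝔸ˣ) : 𝔸) - 1‖ ≤ ‖(b : 𝔸) - 1‖ + ‖(c : 𝔸) - 1‖ :=
    (B8Ineq170.norm_mul_sub_one_le_of_norm_le_one (mem_U1.mp hb).1).trans (add_le_add le_rfl (norm_inv_sub_one_le hc))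
  have h1 := B8Ineq170.norm_mul_sub_one_le_of_norm_le_one (b := (b : 𝔸) * ((c⁻¹ : 𝔸ˣ) : 𝔸)) (mem_U1.mp ha).1
  linarith

/-! ## §2 (B-ii): the flat double bar of the block-constantly gauged block-axial field -/

section StepIdentity

variable [NormedAlgebra ℂ 𝔸] [CompleteSpace 𝔸]

omit [NormOneClass 𝔸] [NormedAlgebra ℂ 𝔸] [CompleteSpace 𝔸] in
/-- The comb transporters of a gauged field: `(u•C)(Γ_{q,q+r}) = u(q)·C(Γ_{q,q+r})·u(q+r)⁻¹`. [cite: Balaban1985Averaging, (8) p.19, p.24] -/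
theorem hol_treeWord_gaugeAct (u : Site d → 𝔸ˣ) (C : Site d → Fin d → 𝔸ˣ) (q r : Site d) :
    hol (gaugeAct u C) q (treeWord r) = u q * hol C q (treeWord r) * (u (q + r))⁻¹ := by
  rw [hol_gaugeAct, disp_treeWord]

omit [NormOneClass 𝔸] [NormedAlgebra ℂ 𝔸] [CompleteSpace 𝔸] in
/-- A field that is block-axial on the block `B(q)` stays block-axial there after a gauge transformation CONSTANT on `B(q)`. [cite: Balaban1985Averaging, p.24] -/
theorem hol_treeWord_boxVec_gaugeAct_eq_one (L : ℕ) (u : Site d → 𝔸ˣ) (C : Site d → Fin d → 𝔸ˣ) (q : Site d)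
    (hC : ∀ r : Fin d → Fin L, hol C q (treeWord (boxVec L r)) = 1) (hu : ∀ r : Fin d → Fin L, u (q + boxVec L r) = u q) (r : Fin d → Fin L) :
    hol (gaugeAct u C) q (treeWord (boxVec L r)) = 1 := by
  rw [hol_treeWord_gaugeAct, hC r, mul_one, hu r, mul_inv_cancel]

omit [NormOneClass 𝔸] in
/-- ★ **(B-ii) THE `ℤᵈ` STEP IDENTITY.**  For a field `C` block-axial on the two blocks `B(Lz)`, `B(L(z + e_κ))` of the `L`-bond `c = ⟨Lz, Lz + Le_κ⟩` (J3 (b) letters) and a gauge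
`v` CONSTANT on each of the two blocks, the flat double bar (89) of `v•C` at `c` is the single bar (42) of `C` conjugated by the two constants:
`dbavg L (v•C) (Lz) κ = v(Lz)·bavg L C (Lz) κ·v(L(z + e_κ))⁻¹` — UNCONDITIONALLY (lit ✓`B7Prop6Flat.bavg_gaugeAct_units`, the unit-valued twin of print's (11)).
[cite: Balaban1985Averaging, (11) p.19, (42) p.23, (89) p.31] -/
theorem dbavg_gaugeAct_eq_of_blockConst (L : ℕ) (C : Site d → Fin d → 𝔸ˣ) (v : Site d → 𝔸ˣ) (z : Site d) (κ : Fin d)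
    (hC0 : ∀ r : Fin d → Fin L, axialFn C ((L : ℤ) • z) ((L : ℤ) • z + boxVec L r) = 1)
    (hC1 : ∀ r : Fin d → Fin L, axialFn C ((L : ℤ) • (z + e κ)) ((L : ℤ) • (z + e κ) + boxVec L r) = 1)
    (hv0 : ∀ r : Fin d → Fin L, v ((L : ℤ) • z + boxVec L r) = v ((L : ℤ) • z))
    (hv1 : ∀ r : Fin d → Fin L, v ((L : ℤ) • (z + e κ) + boxVec L r) = v ((L : ℤ) • (z + e κ))) :
    dbavg L (gaugeAct v C) ((L : ℤ) • z) κ = v ((L : ℤ) • z) * bavg L C ((L : ℤ) • z) κ * (v ((L : ℤ) • (z + e κ)))⁻¹ := by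
  have h0 := hol_treeWord_boxVec_gaugeAct_eq_one L v C _ (hol_treeWord_boxVec_eq_one_of_axialFn L C z hC0) hv0
  have h1 := hol_treeWord_boxVec_gaugeAct_eq_one L v C _ (hol_treeWord_boxVec_eq_one_of_axialFn L C (z + e κ) hC1) hv1
  have hq : (L : ℤ) • z + (L : ℤ) • e κ = (L : ℤ) • (z + e κ) := (smul_add _ _ _).symm
  rw [dbavg_eq_bavg_of_blockAxial L _ _ κ h0 (by rw [hq]; exact h1), B7Prop6Flat.bavg_gaugeAct_units L v C _ κ, hq]

end StepIdentity

/-! ## §3 (B-i): every bond of the pair-gauged field in the corner box is small -/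

section PairGauge

omit [NormOneClass 𝔸] in
/-- Sites of the corner box `Q = [Lz, bondHi L (Lz) κ]` of `c = ⟨Lz, Lz + Le_κ⟩` lie in one of its two blocks: `x = Lz + r` or `x = L(z + e_κ) + r`, `r ∈ [0, L)ᵈ`. [folklore] -/
theorem exists_boxVec_of_inBox_bondHi {L : ℕ} (z : Site d) (κ : Fin d) {x : Site d} (hx : InBox ((L : ℤ) • z) (bondHi L ((L : ℤ) • z) κ) x) :
    (∃ r : Fin d → Fin L, x = (L : ℤ) • z + boxVec L r) ∨ (∃ r : Fin d → Fin L, x = (L : ℤ) • (z + e κ) + boxVec L r) := by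
  have hx' : ∀ i, (L : ℤ) * z i ≤ x i ∧ x i ≤ (L : ℤ) * z i + ((L : ℤ) - 1) + (if i = κ then (L : ℤ) else 0) := fun i => by
    simpa only [InBox, bondHi, Pi.smul_apply, smul_eq_mul] using hx i
  by_cases hk : x κ < (L : ℤ) * z κ + L
  · refine Or.inl ⟨fun i => ⟨(x i - (L : ℤ) * z i).toNat, ?_⟩, funext fun i => ?_⟩
    · have h := hx' i
      by_cases hi : i = κ
      · subst hi; omega
      · rw [if_neg hi] at h; omega
    · have h := (hx' i).1
      simp only [Pi.add_apply, Pi.smul_apply, smul_eq_mul, boxVec]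
      omega
  · refine Or.inr ⟨fun i => ⟨(x i - (L : ℤ) * (z + e κ) i).toNat, ?_⟩, funext fun i => ?_⟩
    · have h := hx' i
      simp only [Pi.add_apply, e_apply]
      by_cases hi : i = κ
      · subst hi; rw [if_pos rfl] at h; rw [if_pos rfl, mul_add, mul_one]; omega
      · rw [if_neg hi] at h; rw [if_neg hi, add_zero]; omega
    · have h := (hx' i).1
      simp only [Pi.add_apply, Pi.smul_apply, smul_eq_mul, boxVec, e_apply]
      by_cases hi : i = κ
      · subst hi; rw [if_pos rfl, mul_add, mul_one]; omega
      · rw [if_neg hi, add_zero]; omega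

omit [NormOneClass 𝔸] in
/-- A block site `Lz + r` lies in the corner box of every `L`-bond from `Lz`, and so does `L(z + e_κ) + r`. [folklore] -/
theorem inBox_bondHi_of_boxVec (L : ℕ) (z : Site d) (κ : Fin d) (r : Fin d → Fin L) :
    InBox ((L : ℤ) • z) (bondHi L ((L : ℤ) • z) κ) ((L : ℤ) • z + boxVec L r) ∧
      InBox ((L : ℤ) • z) (bondHi L ((L : ℤ) • z) κ) ((L : ℤ) • (z + e κ) + boxVec L r) := by
  refine ⟨fun i => ?_, fun i => ?_⟩
  · have := (r i).isLt
    simp only [Pi.add_apply, Pi.smul_apply, smul_eq_mul, boxVec, bondHi]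
    split_ifs <;> omega
  · have := (r i).isLt
    simp only [Pi.add_apply, Pi.smul_apply, smul_eq_mul, boxVec, bondHi, e_apply]
    split_ifs <;> simp only [mul_add, mul_one, add_zero] <;> omega

variable [NormedAlgebra ℂ 𝔸] [CompleteSpace 𝔸]

omit [NormOneClass 𝔸] [NormedAlgebra ℂ 𝔸] [CompleteSpace 𝔸] in
/-- The comb transporter of the comb-axially gauged field between the second corner and a point of a block-axial second block is the ratio of the two comb transporters from the
first corner: `axialFn ((axialFn C q)•C) q′ y = axialFn C q q′ · (axialFn C q y)⁻¹` when `axialFn C q′ y = 1`. [cite: Balaban1985Averaging, p.24] -/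
theorem axialFn_gaugeAct_axialFn_eq (C : Site d → Fin d → 𝔸ˣ) (q q' y : Site d) (hy : axialFn C q' y = 1) :
    axialFn (gaugeAct (axialFn C q) C) q' y = axialFn C q q' * (axialFn C q y)⁻¹ := by
  unfold axialFn at hy ⊢
  rw [hol_gaugeAct, disp_treeWord, hy, mul_one, add_sub_cancel]

omit [NormedAlgebra ℂ 𝔸] [CompleteSpace 𝔸] in
/-- Comb transporters under a uniform in-box bond bound: `‖axialFn W y x − 1‖ ≤ |x − y|₁·b` for `y, x` in the box. [folklore] -/
theorem norm_axialFn_sub_one_le_of_bondBound (W : Site d → Fin d → 𝔸ˣ) (hW : ∀ x κ, W x κ ∈ U1 𝔸) {lo hi : Site d} {b : ℝ}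
    (hB : ∀ (x : Site d) (μ : Fin d), lo ≤ x → x + e μ ≤ hi → ‖((W x μ : 𝔸ˣ) : 𝔸) - 1‖ ≤ b)
    {y x : Site d} (hy : lo ≤ y) (hy' : y ≤ hi) (hx : lo ≤ x) (hx' : x ≤ hi) :
    ‖((axialFn W y x : 𝔸ˣ) : 𝔸) - 1‖ ≤ l1 (x - y) * b := by
  have hw := tw_walk_box W hW hB (List.finRange d).reverse (List.nodup_reverse.mpr (List.nodup_finRange d)) (x - y) y hy hy'
    (fun κ _ => by simp only [Pi.sub_apply, add_sub_cancel]; exact ⟨hx κ, hx' κ⟩)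
  rw [← treeWord_eq_tw] at hw
  refine hw.trans (le_of_eq ?_)
  rw [List.map_reverse, List.sum_reverse, ← Fin.sum_univ_def, ← Finset.sum_mul]
  simp only [l1, Nat.cast_sum]

omit [NormedAlgebra ℂ 𝔸] [CompleteSpace 𝔸] in
/-- ★ **(B-i) THE PAIR GAUGE IS SMALL ON THE CORNER BOX.**  `C` block-axial on `B(Lz)` and `B(L(z+e_κ))`, with plaquettes `≤ p` on the corner box `Q = [Lz, bondHi L (Lz) κ]`,
`U1`-valued; `v` (`U1`-valued) equal to `1` on `B(Lz)` and to the axis transporter `axialFn C (Lz) (L(z+e_κ))` on `B(L(z+e_κ))`.  Then every bond of `v•C` in `Q` is within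
`(2·d·L + 1)·(|bondHi L (Lz) κ − Lz|₁·p)` of `1`. [cite: Balaban1985Averaging, p.24; Balaban1985UV3, (27)-(28) p.263] -/
theorem norm_gaugeAct_pairGauge_sub_one_le {L : ℕ} (hL : 1 ≤ L) (C : Site d → Fin d → 𝔸ˣ) (hCU : ∀ x μ, C x μ ∈ U1 𝔸) (v : Site d → 𝔸ˣ)
    (hv : ∀ x, v x ∈ U1 𝔸) (z : Site d) (κ : Fin d) {p : ℝ} (hp : 0 ≤ p) (hP : PlaqSmall C ((L : ℤ) • z) (bondHi L ((L : ℤ) • z) κ) p)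
    (hC0 : ∀ r : Fin d → Fin L, axialFn C ((L : ℤ) • z) ((L : ℤ) • z + boxVec L r) = 1)
    (hC1 : ∀ r : Fin d → Fin L, axialFn C ((L : ℤ) • (z + e κ)) ((L : ℤ) • (z + e κ) + boxVec L r) = 1)
    (hv0 : ∀ r : Fin d → Fin L, v ((L : ℤ) • z + boxVec L r) = 1)
    (hv1 : ∀ r : Fin d → Fin L, v ((L : ℤ) • (z + e κ) + boxVec L r) = axialFn C ((L : ℤ) • z) ((L : ℤ) • (z + e κ)))
    (x : Site d) (μ : Fin d) (hx : InBox ((L : ℤ) • z) (bondHi L ((L : ℤ) • z) κ) x) (hxe : InBox ((L : ℤ) • z) (bondHi L ((L : ℤ) • z) κ) (x + e μ)) :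
    ‖((gaugeAct v C x μ : 𝔸ˣ) : 𝔸) - 1‖ ≤ (2 * (d * L : ℕ) + 1) * (l1 (bondHi L ((L : ℤ) • z) κ - (L : ℤ) • z) * p) := by
  set q : Site d := (L : ℤ) • z with hq
  set q' : Site d := (L : ℤ) • (z + e κ) with hq'
  set δ : ℝ := l1 (bondHi L q κ - q) * p with hδ
  set W₁ := gaugeAct (axialFn C q) C with hW₁
  have hW₁U : ∀ x μ, W₁ x μ ∈ U1 𝔸 := gaugeAct_mem hCU (axialFn_mem hCU q)
  have hδ0 : 0 ≤ δ := mul_nonneg (Nat.cast_nonneg _) hp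
  -- every bond of the comb-axially gauged field in `Q` is `δ`-small (Lemma 1, non-abelian, sharp form)
  have hB : ∀ (y : Site d) (ν : Fin d), q ≤ y → y + e ν ≤ bondHi L q κ → ‖((W₁ y ν : 𝔸ˣ) : 𝔸) - 1‖ ≤ δ := fun y ν hy hye =>
    (axial_bond_bound_sharp C hCU hP q y ν le_rfl hy hye).trans (mul_le_mul_of_nonneg_right (by exact_mod_cast l1_lowPart_sub_le ν hy hye) hp)
  -- the ratio gauge `h = v·(axialFn C q)⁻¹` and the factorisation `v•C = h•W₁`
  have hfac : ∀ (y : Site d) (ν : Fin d), gaugeAct v C y ν = (v y * (axialFn C q y)⁻¹) * W₁ y ν * (v (y + e ν) * (axialFn C q (y + e ν))⁻¹)⁻¹ := fun y ν => by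
    simp only [hW₁, gaugeAct, mul_inv_rev, inv_inv, mul_assoc, inv_mul_cancel_left]
  -- `h = 1` on the first block, `h = axialFn W₁ q′ ·` on the second, hence `‖h − 1‖ ≤ d·L·δ` on `Q`
  have hh : ∀ y : Site d, InBox q (bondHi L q κ) y → ‖(((v y * (axialFn C q y)⁻¹ : 𝔸ˣ)) : 𝔸) - 1‖ ≤ (d * L : ℕ) * δ := by
    intro y hy
    rcases exists_boxVec_of_inBox_bondHi z κ hy with ⟨r, rfl⟩ | ⟨r, rfl⟩
    · rw [hv0 r, hC0 r, inv_one, mul_one, Units.val_one, sub_self, norm_zero]; positivity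
    · have hrat : v (q' + boxVec L r) * (axialFn C q (q' + boxVec L r))⁻¹ = axialFn W₁ q' (q' + boxVec L r) := by
        rw [hv1 r, axialFn_gaugeAct_axialFn_eq C q q' _ (hC1 r)]
      rw [hrat]
      have hq'in : InBox q (bondHi L q κ) q' := by
        have h0 : boxVec L (fun _ : Fin d => (⟨0, hL⟩ : Fin L)) = 0 := funext fun i => by simp [boxVec]
        have h2 := (inBox_bondHi_of_boxVec L z κ (fun _ => ⟨0, hL⟩)).2
        rwa [h0, add_zero] at h2
      have hyin := (inBox_bondHi_of_boxVec L z κ r).2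
      refine (norm_axialFn_sub_one_le_of_bondBound W₁ hW₁U hB (fun i => (hq'in i).1) (fun i => (hq'in i).2) (fun i => (hyin i).1)
        (fun i => (hyin i).2)).trans (mul_le_mul_of_nonneg_right ?_ hδ0)
      rw [add_sub_cancel_left]; exact_mod_cast l1_boxVec_le L r
  -- assemble
  rw [hfac x μ]
  have hxU : v x * (axialFn C q x)⁻¹ ∈ U1 𝔸 := (U1 𝔸).mul_mem (hv x) ((U1 𝔸).inv_mem (axialFn_mem hCU q x))
  have hxeU : v (x + e μ) * (axialFn C q (x + e μ))⁻¹ ∈ U1 𝔸 := (U1 𝔸).mul_mem (hv _) ((U1 𝔸).inv_mem (axialFn_mem hCU q _))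
  calc _ ≤ ‖(((v x * (axialFn C q x)⁻¹ : 𝔸ˣ)) : 𝔸) - 1‖ + ‖((W₁ x μ : 𝔸ˣ) : 𝔸) - 1‖ + ‖(((v (x + e μ) * (axialFn C q (x + e μ))⁻¹ : 𝔸ˣ)) : 𝔸) - 1‖ :=
        norm_mul_mul_inv_sub_one_le hxU (hW₁U x μ) hxeU
    _ ≤ (d * L : ℕ) * δ + δ + (d * L : ℕ) * δ := add_le_add_three (hh x hx) (hB x μ (fun i => (hx i).1) (fun i => (hxe i).2)) (hh _ hxe)
    _ = (2 * (d * L : ℕ) + 1) * δ := by push_cast; ring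

end PairGauge

end Summit.QuantumFields.YangMills.Theorems.HalvingCombPairGauge

end
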